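import Summits.PneNP.PneNP.Theorems.SzkEntropyPeaThreeNotInPLatticeDefs
import Literature.Algebra.EuclideanLattices.GapSVPVerifier
import HarnessLib

/-!
# Route SzkEntropy, crux `PeaThreeNotInP` (stmt-PneNP-10776), line `SketchIdeator3`, socket client
# `lattice-cube-smoothing`: the lattice geometry stub `stub_geometry`

Three elementary facts about an integer lattice `L(B) ⊆ ℝⁿ` (ROWS of `B ∈ ℤⁿˣⁿ` are the basis
vectors, lattice vectors are the `z B = Matrix.vecMul z B`) and an integer target `t`, used by the
Karp reduction `GapCVP_n → PEDBPGap 1 10` of the definitions file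
`SzkEntropyPeaThreeNotInPLatticeDefs.lean`:

* (far) `geom_far`: if `√n · K · d ≥ M − 1` (`M = 2^m`) and `dist(t, L(B)) > n d`, then the two
  translates `f(z, e) = K·(z B) + e + K t` and `g(z, e) = K·(z B) + e` of the cube-smoothed
  sampler never collide: a collision `f(z, e) = g(z', e')` puts `t = (z' − z) B + (e' − e)/K` at
  distance `‖e' − e‖ / K ≤ √n (M − 1) / K ≤ n d` from `L(B)`.
* (close) `geom_close`: if `dist(t, L(B)) ≤ d` then `K t = K·(z₀ B) + w` with `w ∈ ℤⁿ`,
  `‖w‖ ≤ K d` and `|z₀ᵢ| ≤ n! Sⁿ`: a closest vector `z₀ B` is attained (`L(B)` is discrete, hence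
  closed, in the proper space `ℝⁿ`), `w := K (t − z₀ B)`, and the coefficients of `z₀ B` (whose
  coordinates are `≤ |tᵢ| + d ≤ S`) are bounded by Cramer's rule with Hadamard's inequality
  (`natAbs_coeff_le`).
* (one-dim) `geom_oneDim`: `dist(t, g ℤ) = min (t mod |g|, |g| − t mod |g|)` for `g ≠ 0`.

References: O. Goldreich, S. Goldwasser, J. Comput. Syst. Sci. 60 (2000) §3 (ball / cube overlap
for `GapCVP`); D. Micciancio, S. Goldwasser, *Complexity of Lattice Problems* (2002) Ch. 1 §1.2–1.3.
-/

namespace Summit.PneNP.PneNP.Cruxes.PeaThreeNotInP.LatticeLine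

set_option linter.dupNamespace false -- `Summit.PneNP.PneNP.…`: summit = sub-problem name (D-0017)

open Finset Metric
open Literature.Algebra.EuclideanLattices

/-! ### Small lattice facts -/

/-- The lattice vector with coefficient vector `z` is the integer vector `z B` viewed in `ℝⁿ`.
[cite: MicciancioGoldwasser2002, Ch. 1 §1.2] -/
theorem geom_ofCoeffs_eq {n : ℕ} (B : Matrix (Fin n) (Fin n) ℤ) (z : Fin n → ℤ) :
    (⟨n, B⟩ : LatticeInstance).ofCoeffs z = intVecToEuclidean n (Matrix.vecMul z B) := rfl

/-- A closest lattice vector is attained: `L(B)` is a discrete, hence closed, subgroup of the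
proper space `ℝⁿ`, and it is nonempty. [cite: MicciancioGoldwasser2002, Ch. 1 §1.2] -/
theorem geom_exists_closest {n : ℕ} (B : Matrix (Fin n) (Fin n) ℤ) (x : EuclideanSpace ℝ (Fin n)) :
    ∃ z₀ : Fin n → ℤ, infDist x ((⟨n, B⟩ : LatticeInstance).lattice : Set (EuclideanSpace ℝ (Fin n))) =
      dist x ((⟨n, B⟩ : LatticeInstance).ofCoeffs z₀) := by
  have hclosed : IsClosed (X := EuclideanSpace ℝ (Fin n)) (⟨n, B⟩ : LatticeInstance).lattice :=
    @AddSubgroup.isClosed_of_discrete _ _ _ _ _ (⟨n, B⟩ : LatticeInstance).lattice.toAddSubgroup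
      (LatticeInstance.instDiscreteTopologyLattice ⟨n, B⟩)
  obtain ⟨w, hwL, hw⟩ :=
    hclosed.exists_infDist_eq_dist ⟨0, (⟨n, B⟩ : LatticeInstance).lattice.zero_mem⟩ x
  obtain ⟨z, rfl⟩ := ((⟨n, B⟩ : LatticeInstance).mem_lattice_iff w).1 hwL
  exact ⟨z, hw⟩

/-- `K · (z B)ᵢ = ∑_{i'} K B_{i' i} z_{i'}` (the coordinate form used by the samplers). [folklore] -/
theorem geom_mul_vecMul {n : ℕ} (K : ℤ) (B : Matrix (Fin n) (Fin n) ℤ) (z : Fin n → ℤ) (i : Fin n) :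
    K * Matrix.vecMul z B i = ∑ i', K * B i' i * z i' := by
  simp only [Matrix.vecMul, dotProduct, Finset.mul_sum]
  exact Finset.sum_congr rfl fun j _ => by ring

/-! ### (far) Disjoint translates -/

/-- **Far instances give disjoint translates.**  If `√n · K · d ≥ 2^m − 1` and
`dist(t, L(B)) > n · d`, then `K·(z B) + e + K t ≠ K·(z' B) + e'` for all `z, z'` and all noise
vectors `e, e' ∈ [0, 2^m)ⁿ`: otherwise `t = (z' − z) B + (e' − e)/K` would be at distance
`‖e' − e‖ / K ≤ √n (2^m − 1) / K ≤ n d` from the lattice. [cite: GoldreichGoldwasser2000, §3] -/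
theorem geom_far (n : ℕ) (B : Matrix (Fin n) (Fin n) ℤ) (t : Fin n → ℤ) (d : ℚ) (K : ℤ) (ℓ m : ℕ)
    (hK : 0 < K) (hm : ((2 ^ m : ℕ) : ℝ) - 1 ≤ Real.sqrt n * K * d)
    (hfar : (n : ℝ) * d < infDist (intVecToEuclidean n t)
      ((⟨n, B⟩ : LatticeInstance).lattice : Set (EuclideanSpace ℝ (Fin n))))
    (ze ze' : Box n ℓ m) : sampF n K B t ze ≠ sampG n K B ze' := by
  intro heq
  -- the coefficient difference `z = z' − z` and the noise difference `e = e' − e`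
  set z : Fin n → ℤ := fun i' => ((ze'.1 i' : ℕ) : ℤ) - ((ze.1 i' : ℕ) : ℤ) with hz
  set e : Fin n → ℤ := fun i => ((ze'.2 i : ℕ) : ℤ) - ((ze.2 i : ℕ) : ℤ) with he
  have hKz : ∀ i, K * Matrix.vecMul z B i =
      (∑ i', K * B i' i * ((ze'.1 i' : ℕ) : ℤ)) - ∑ i', K * B i' i * ((ze.1 i' : ℕ) : ℤ) := by
    intro i
    rw [geom_mul_vecMul, ← Finset.sum_sub_distrib]
    exact Finset.sum_congr rfl fun j _ => by rw [hz]; ring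
  have hi : ∀ i, K * t i = K * Matrix.vecMul z B i + e i := by
    intro i
    have h := congrFun heq i
    simp only [sampF, sampG] at h
    simp only [hKz, he]
    linarith
  -- in `ℝⁿ`: `K • (t − z B) = e`
  have hvec : (K : ℝ) • (intVecToEuclidean n t - (⟨n, B⟩ : LatticeInstance).ofCoeffs z) =
      intVecToEuclidean n e := by
    ext j
    simp only [PiLp.smul_apply, PiLp.sub_apply, geom_ofCoeffs_eq, intVecToEuclidean_apply, smul_eq_mul]
    have h' : ((K * t j : ℤ) : ℝ) = ((K * Matrix.vecMul z B j + e j : ℤ) : ℝ) := by rw [hi j]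
    push_cast at h'
    linarith
  have hKdist : (K : ℝ) * dist (intVecToEuclidean n t) ((⟨n, B⟩ : LatticeInstance).ofCoeffs z) =
      ‖intVecToEuclidean n e‖ := by
    rw [dist_eq_norm, ← hvec, norm_smul, Real.norm_eq_abs, abs_of_pos (by exact_mod_cast hK)]
  -- `‖e‖ ≤ √n (2^m − 1)`
  set M1 : ℝ := ((2 ^ m : ℕ) : ℝ) - 1 with hM1
  have hM1nn : 0 ≤ M1 := by
    rw [hM1, sub_nonneg]
    exact_mod_cast Nat.one_le_two_pow
  have hej : ∀ j, ((e j : ℝ)) ^ 2 ≤ M1 ^ 2 := by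
    intro j
    have h1 : ((ze'.2 j : ℕ) : ℝ) + 1 ≤ ((2 ^ m : ℕ) : ℝ) := by
      exact_mod_cast Nat.succ_le_of_lt (ze'.2 j).isLt
    have h2 : ((ze.2 j : ℕ) : ℝ) + 1 ≤ ((2 ^ m : ℕ) : ℝ) := by
      exact_mod_cast Nat.succ_le_of_lt (ze.2 j).isLt
    have h3 : (0 : ℝ) ≤ ((ze'.2 j : ℕ) : ℝ) := Nat.cast_nonneg _
    have h4 : (0 : ℝ) ≤ ((ze.2 j : ℕ) : ℝ) := Nat.cast_nonneg _
    have hej' : (e j : ℝ) = ((ze'.2 j : ℕ) : ℝ) - ((ze.2 j : ℕ) : ℝ) := by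
      rw [he]
      push_cast
      ring
    rw [hej']
    apply sq_le_sq' <;> linarith
  have hnorm : ‖intVecToEuclidean n e‖ ≤ Real.sqrt n * M1 := by
    rw [norm_intVecToEuclidean]
    calc √(∑ j, ((e j : ℝ)) ^ 2) ≤ √(∑ _j : Fin n, M1 ^ 2) :=
          Real.sqrt_le_sqrt (Finset.sum_le_sum fun j _ => hej j)
      _ = √((n : ℝ) * M1 ^ 2) := by
          rw [Finset.sum_const, Finset.card_univ, Fintype.card_fin, nsmul_eq_mul]
      _ = Real.sqrt n * M1 := by rw [Real.sqrt_mul (Nat.cast_nonneg n), Real.sqrt_sq hM1nn]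
  -- `K · dist(t, z B) = ‖e‖ ≤ √n (2^m − 1) ≤ √n · √n K d = K (n d)`
  have hle : dist (intVecToEuclidean n t) ((⟨n, B⟩ : LatticeInstance).ofCoeffs z) ≤ (n : ℝ) * d := by
    have hK' : (0 : ℝ) < K := by exact_mod_cast hK
    refine le_of_mul_le_mul_left ?_ hK'
    calc (K : ℝ) * dist (intVecToEuclidean n t) ((⟨n, B⟩ : LatticeInstance).ofCoeffs z)
          = ‖intVecToEuclidean n e‖ := hKdist
      _ ≤ Real.sqrt n * M1 := hnorm
      _ ≤ Real.sqrt n * (Real.sqrt n * K * d) := mul_le_mul_of_nonneg_left hm (Real.sqrt_nonneg _)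
      _ = (K : ℝ) * ((n : ℝ) * d) := by
          rw [← mul_assoc, ← mul_assoc, Real.mul_self_sqrt (Nat.cast_nonneg n)]
          ring
  have hmem : infDist (intVecToEuclidean n t)
      ((⟨n, B⟩ : LatticeInstance).lattice : Set (EuclideanSpace ℝ (Fin n))) ≤
      dist (intVecToEuclidean n t) ((⟨n, B⟩ : LatticeInstance).ofCoeffs z) :=
    infDist_le_dist_of_mem ((⟨n, B⟩ : LatticeInstance).ofCoeffs_mem_lattice z)
  exact lt_irrefl _ (hfar.trans_le (hmem.trans hle))

/-! ### (close) The closest vector and its coefficients -/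

/-- **Close instances: the scaled target is a lattice vector plus a short integer error with
small coefficients.**  If `dist(t, L(B)) ≤ d`, `|B_{i' i}| ≤ S` and `|tᵢ| + d ≤ S`, then
`K t = K·(z₀ B) + w` with `∑ wᵢ² ≤ (K d)²` and `|z₀ᵢ| ≤ n! · Sⁿ`: take a closest lattice vector
`z₀ B` (attained, `L(B)` being closed in `ℝⁿ`) and `w = K (t − z₀ B)`; every coordinate of `z₀ B`
is at most `|tᵢ| + dist(t, z₀ B) ≤ |tᵢ| + d ≤ S`, so Cramer's rule and Hadamard's bound
(`natAbs_coeff_le`) bound the coefficients. [cite: MicciancioGoldwasser2002, Ch. 1 §1.3] -/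
theorem geom_close (n : ℕ) (B : Matrix (Fin n) (Fin n) ℤ) (t : Fin n → ℤ) (d : ℚ) (K : ℤ) (S : ℕ)
    (hB : B.det ≠ 0)
    (hle : infDist (intVecToEuclidean n t)
      ((⟨n, B⟩ : LatticeInstance).lattice : Set (EuclideanSpace ℝ (Fin n))) ≤ d)
    (hS : ∀ i j, (B i j).natAbs ≤ S) (htS : ∀ i, ((t i).natAbs : ℝ) + d ≤ S) :
    ∃ z₀ w : Fin n → ℤ, (∀ i, K * t i = (∑ i', K * B i' i * z₀ i') + w i) ∧
      (∑ i, ((w i : ℝ)) ^ 2 ≤ ((K : ℝ) * d) ^ 2) ∧ ∀ i, (z₀ i).natAbs ≤ n.factorial * S ^ n := by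
  obtain ⟨z₀, hz₀⟩ := geom_exists_closest B (intVecToEuclidean n t)
  -- the closest vector `u = z₀ B`, at distance `δ = dist(t, L(B)) ≤ d`
  set u : Fin n → ℤ := Matrix.vecMul z₀ B with hu
  set δ : ℝ := dist (intVecToEuclidean n t) ((⟨n, B⟩ : LatticeInstance).ofCoeffs z₀) with hδ
  have hδd : δ ≤ d := by rw [← hz₀]; exact hle
  have hδ0 : 0 ≤ δ := dist_nonneg
  have hδsq : δ ^ 2 = ∑ k, ((t k : ℝ) - u k) ^ 2 := by
    rw [hδ, dist_eq_norm, geom_ofCoeffs_eq, ← map_sub, norm_sq_intVecToEuclidean]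
    simp only [Int.cast_sum, Int.cast_pow, Int.cast_sub, Pi.sub_apply, hu]
  refine ⟨z₀, fun i => K * (t i - u i), fun i => ?_, ?_, fun i => ?_⟩
  · -- `K tᵢ = ∑ K B_{i' i} z₀_{i'} + K (tᵢ − uᵢ)`
    rw [← geom_mul_vecMul]
    ring
  · -- `∑ wᵢ² = K² δ² ≤ (K d)²`
    have e1 : ∑ i, (((K * (t i - u i) : ℤ) : ℝ)) ^ 2 = (K : ℝ) ^ 2 * δ ^ 2 := by
      rw [hδsq, Finset.mul_sum]
      push_cast
      exact Finset.sum_congr rfl fun i _ => by ring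
    rw [e1, mul_pow]
    exact mul_le_mul_of_nonneg_left (pow_le_pow_left₀ hδ0 hδd 2) (sq_nonneg _)
  · -- `|z₀ᵢ| ≤ n! Sⁿ` by Cramer–Hadamard, since `|u_l| ≤ |t_l| + δ ≤ |t_l| + d ≤ S`
    refine natAbs_coeff_le hB hu.symm hS (fun l => ?_) i
    have h1 : ((t l : ℝ) - u l) ^ 2 ≤ δ ^ 2 := by
      rw [hδsq]
      exact Finset.single_le_sum (f := fun k => ((t k : ℝ) - u k) ^ 2) (fun _ _ => sq_nonneg _)
        (Finset.mem_univ l)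
    have h2 : |(t l : ℝ) - u l| ≤ δ := abs_le_of_sq_le_sq h1 hδ0
    have h3 : |(u l : ℝ)| ≤ |(t l : ℝ)| + δ := by
      have := abs_sub_abs_le_abs_sub (u l : ℝ) (t l)
      rw [abs_sub_comm] at this
      linarith
    have h4 : ((u l).natAbs : ℝ) ≤ S := by
      have h5 := htS l
      rw [Nat.cast_natAbs, Int.cast_abs] at h5 ⊢
      linarith
    exact_mod_cast h4

/-! ### (one-dim) The distance to `g ℤ` -/

/-- The lattice vectors of the one-dimensional instance `⟨1, B⟩` are the multiples `z₀ · B₀₀`. [folklore] -/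
theorem geom_ofCoeffs_fin_one (B : Matrix (Fin 1) (Fin 1) ℤ) (z : Fin 1 → ℤ) :
    (⟨1, B⟩ : LatticeInstance).ofCoeffs z 0 = ((z 0 * B 0 0 : ℤ) : ℝ) := by
  rw [geom_ofCoeffs_eq, intVecToEuclidean_apply]
  simp [Matrix.vecMul, dotProduct]

/-- The residue estimate behind `dist(t, G ℤ) = min (r, G − r)`: for `0 ≤ r < G` and every
integer `j`, `min r (G − r) ≤ |r + G j|` (cases `j = 0`, `j ≥ 1`, `j ≤ −1`). [folklore] -/
theorem geom_min_le_abs (r G j : ℤ) (hr0 : 0 ≤ r) (hrG : r < G) : min r (G - r) ≤ |r + G * j| := by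
  rcases le_or_gt 1 j with hj | hj
  · have h1 : G * 1 ≤ G * j := mul_le_mul_of_nonneg_left hj (by linarith)
    rw [abs_of_nonneg (by linarith)]
    exact (min_le_right _ _).trans (by linarith)
  rcases lt_or_ge j 0 with hj' | hj'
  · have h1 : G * j ≤ G * (-1) := mul_le_mul_of_nonneg_left (by omega) (by linarith)
    rw [abs_of_neg (by linarith)]
    exact (min_le_right _ _).trans (by linarith)
  · obtain rfl : j = 0 := by omega
    rw [mul_zero, add_zero, abs_of_nonneg hr0]
    exact min_le_left _ _

/-- **The distance from an integer to `g ℤ`** (`g ≠ 0`): `dist(t, g ℤ) = min (t mod |g|, |g| − t mod |g|)`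
— the two neighbouring multiples `|g| ⌊t/|g|⌋` and `|g| (⌊t/|g|⌋ + 1)` are at distances `r` and
`|g| − r` (`r = t mod |g|`), and every other multiple is farther. [folklore] -/
theorem geom_oneDim (B : Matrix (Fin 1) (Fin 1) ℤ) (t : Fin 1 → ℤ) (hg : B 0 0 ≠ 0) :
    infDist (intVecToEuclidean 1 t) ((⟨1, B⟩ : LatticeInstance).lattice : Set (EuclideanSpace ℝ (Fin 1))) =
      ((min (t 0 % |B 0 0|) (|B 0 0| - t 0 % |B 0 0|) : ℤ) : ℝ) := by
  generalize hG : |B 0 0| = G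
  have hGpos : 0 < G := by rw [← hG]; exact abs_pos.2 hg
  have hsg : (B 0 0).sign * G = B 0 0 := by rw [← hG]; exact Int.sign_mul_abs _
  have hsg' : (B 0 0).sign * B 0 0 = G := by rw [Int.sign_mul_self_eq_abs, hG]
  set r : ℤ := t 0 % G with hr
  set q : ℤ := t 0 / G with hq
  have hr0 : 0 ≤ r := Int.emod_nonneg _ hGpos.ne'
  have hrG : r < G := Int.emod_lt_of_pos _ hGpos
  have ht : t 0 = G * q + r := (Int.mul_ediv_add_emod _ _).symm
  -- distances from `t` to the lattice points `z₀ g` (a distance in `ℝ¹` is the absolute difference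
  -- of the single coordinates)
  have hdist : ∀ z : Fin 1 → ℤ, dist (intVecToEuclidean 1 t) ((⟨1, B⟩ : LatticeInstance).ofCoeffs z) = ((|t 0 - z 0 * B 0 0| : ℤ) : ℝ) := by
    intro z
    rw [EuclideanSpace.dist_eq, Fin.sum_univ_one, Real.sqrt_sq dist_nonneg, Real.dist_eq,
      geom_ofCoeffs_fin_one, intVecToEuclidean_apply]
    push_cast
    rfl
  apply le_antisymm
  · -- the two neighbours `G q = (q · sign g) g` and `G (q + 1)` are at distances `r` and `G − r`
    rw [Int.cast_min]
    apply le_min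
    · have e1 : t 0 - q * (B 0 0).sign * B 0 0 = r := by rw [mul_assoc, hsg', ht]; ring
      calc infDist (intVecToEuclidean 1 t) ((⟨1, B⟩ : LatticeInstance).lattice : Set (EuclideanSpace ℝ (Fin 1)))
            ≤ dist (intVecToEuclidean 1 t) ((⟨1, B⟩ : LatticeInstance).ofCoeffs fun _ => q * (B 0 0).sign) :=
            infDist_le_dist_of_mem ((⟨1, B⟩ : LatticeInstance).ofCoeffs_mem_lattice _)
        _ = (r : ℝ) := by rw [hdist, e1, abs_of_nonneg hr0]
    · have e2 : t 0 - (q + 1) * (B 0 0).sign * B 0 0 = r - G := by rw [mul_assoc, hsg', ht]; ring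
      calc infDist (intVecToEuclidean 1 t) ((⟨1, B⟩ : LatticeInstance).lattice : Set (EuclideanSpace ℝ (Fin 1)))
            ≤ dist (intVecToEuclidean 1 t) ((⟨1, B⟩ : LatticeInstance).ofCoeffs fun _ => (q + 1) * (B 0 0).sign) :=
            infDist_le_dist_of_mem ((⟨1, B⟩ : LatticeInstance).ofCoeffs_mem_lattice _)
        _ = ((G - r : ℤ) : ℝ) := by
            rw [hdist, e2, abs_sub_comm, abs_of_nonneg (sub_nonneg.2 hrG.le)]
  · -- every lattice point `z₀ g = G k` is at distance `|r + G (q − k)| ≥ min r (G − r)`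
    refine (le_infDist ⟨0, (⟨1, B⟩ : LatticeInstance).lattice.zero_mem⟩).2 fun y hy => ?_
    obtain ⟨z, rfl⟩ := ((⟨1, B⟩ : LatticeInstance).mem_lattice_iff y).1 hy
    rw [hdist]
    have e3 : t 0 - z 0 * B 0 0 = r + G * (q - z 0 * (B 0 0).sign) := by
      have : z 0 * B 0 0 = z 0 * (B 0 0).sign * G := by rw [mul_assoc, hsg]
      rw [this, ht]
      ring
    rw [e3]
    exact_mod_cast geom_min_le_abs r G _ hr0 hrG

/-! ### Assembly -/

/-- **(W3) Lattice geometry.**  (far) if `√n K d ≥ M − 1` and `dist(t, L(B)) > n d` then the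
translates `f = g + K t` and `g` of the cube-smoothed sampler have disjoint images (else
`t ∈ L(B) + (e' − e)/K`, at distance `≤ √n (M−1)/K ≤ n d`); (close) if `dist(t, L(B)) ≤ d` then
`K t = K·(z₀ B) + w` with `w ∈ ℤⁿ`, `‖w‖ ≤ K d` and `|z₀ᵢ| ≤ n! Sⁿ` (closest vector attained, L(B)
discrete; Cramer–Hadamard `natAbs_coeff_le`); (one-dim) `dist(t, g ℤ) = min (t mod |g|, |g| − t mod |g|)`.
[cite: GoldreichGoldwasser2000, §3] -/
theorem stub_geometry : (∀ (n : ℕ) (B : Matrix (Fin n) (Fin n) ℤ) (t : Fin n → ℤ) (d : ℚ) (K : ℤ) (ℓ m : ℕ), B.det ≠ 0 → 0 < K → ((2 ^ m : ℕ) : ℝ) - 1 ≤ Real.sqrt n * K * d → (n : ℝ) * d < infDist (intVecToEuclidean n t) (LatticeInstance.lattice ⟨n, B⟩ : Set (EuclideanSpace ℝ (Fin n))) → ∀ ze ze' : Box n ℓ m, sampF n K B t ze ≠ sampG n K B ze') ∧ (∀ (n : ℕ) (B : Matrix (Fin n) (Fin n) ℤ) (t : Fin n → ℤ) (d : ℚ)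 (K : ℤ) (S : ℕ), B.det ≠ 0 → 0 < K → infDist (intVecToEuclidean n t) (LatticeInstance.lattice ⟨n, B⟩ : Set (EuclideanSpace ℝ (Fin n))) ≤ d → (∀ i j, (B i j).natAbs ≤ S) → (∀ i, ((t i).natAbs : ℝ) + d ≤ S) → ∃ z₀ w : Fin n → ℤ, (∀ i, K * t i = (∑ i', K * B i' i * z₀ i') + w i) ∧ (∑ i, ((w i : ℝ)) ^ 2 ≤ ((K : ℝ) * d) ^ 2) ∧ ∀ i, (z₀ i).natAbs ≤ n.factorial * S ^ n) ∧ (∀ (B : Matrix (Fin 1) (Fin 1) ℤ) (t : Fin 1 → ℤ), B 0 0 ≠ 0 → infDist (intVecToEuclidean 1 t) (LatticeInstance.lattice ⟨1, B⟩ : Set (EuclideanSpace ℝ (Fin 1))) = ((min (t 0 % |B 0 0|) (|B 0 0| - t 0 % |B 0 0|) : ℤ) : ℝ)) :=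
  ⟨fun n B t d K ℓ m _ hK hm hfar => geom_far n B t d K ℓ m hK hm hfar,
    fun n B t d K S hB _ hle hS htS => geom_close n B t d K S hB hle hS htS,
    fun B t hg => geom_oneDim B t hg⟩

end Summit.PneNP.PneNP.Cruxes.PeaThreeNotInP.LatticeLine
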